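import Summits.QuantumFields.YangMills.Theses.EquipartitionCriticality
import Summits.QuantumFields.YangMills.Theorems.LangevinControlUVLatticeGapInUVUnitsReduction

/-!
# `LatticeGapLargeBeta` from ONE local Poincaré inequality of the overlapping block heat bath at a β-dependent scale

Support file for crux stmt-QuantumFields-8761
(`Summit.QuantumFields.YangMills.Theses.EquipartitionCriticality.LatticeGapLargeBeta`; lead of line `Sketch`,
2026-08-16).  The kernel-checked block-sampler pipeline of crux `LatticeGapInUVUnits` (route `LangevinControlUV`,
line `knabe-block-sampler`: Knabe amplification S1, sampler transcription S3, gap ⇒ clustering S4 with the spectral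
toolkit S5 and the light cone S6 — all LANDED, assembled in
`LatticeGapInUVUnits.KnabeBlockSampler.reduction_concl_of_localPoincare`) is transferred to THIS crux, where it is
strictly more comfortable: `LatticeGapLargeBeta` leaves the rate `m(β) > 0` FREE (no UV units), so the "unit map"
`a(β) → 0` below is a free β-dependent SCALE (cell side `⌈K/a(β)⌉`, think `K·ξ(β)`) and not a constraint, and the
topological-freezing objection recorded against 0-form block devices for rates in UV units does not arise.

* `latticeGapLargeBeta_of_blockSamplerLocalPoincare` — the hypothesis (written out inline, in the pipeline's own
  vocabulary `WilsonBlockHeatBath.LocalPoincare`): for every compact simple `G` and faithful `r` there are a unit map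
  `a(β) > 0`, `a → 0`, and constants `K, γ > 0` such that for every patch size `n₀ ≥ 1`, for all large `β` and all
  tori of side `N ≥ (4n₀+8)⌈K/a(β)⌉`, the overlapping block heat bath with nominal cell `⌈K/a(β)⌉` satisfies the
  local Poincaré inequality on `n₀`-patches with constant `γ` (gauge-invariant bounded measurable functions);
  the conclusion is the crux BY NAME, with rate `m(β) = c₁ · a(β)` and β-UNIFORM constants `C(A,B)` (no absorption
  needed: `γ` is β-uniform).

This is a one-scale block criterion at the 0-form (Poincaré) level, the analogue of the 1-form block criterion
`OneBlockBottom` of card `one-form-witten-ims`; like every currency at this level it is, at fixed `β`, morally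
equivalent to the gap (strong mixing at scale `ξ(β)`), and it is FALSE for `U(1)₄` in the Coulomb phase, so no
group-blind argument proves it (barrier `AbelianDeconfinementD4` respected).
-/

noncomputable section

open MeasureTheory Filter Topology
open Literature.MathematicalPhysics.QuantumFieldTheory Literature.MathematicalPhysics.QuantumLattice
open Literature.MathematicalPhysics.QuantumLattice.WilsonBlockHeatBath

namespace Summit.QuantumFields.YangMills.Theorems.LatticeGapLargeBeta

/-- **The crux `LatticeGapLargeBeta` from the block-sampler local Poincaré inequality at one β-dependent scale.**
Hypothesis: for every compact simple `G` and faithful `r` there are a unit map `a : ℝ → ℝ` (`a(β) > 0`, `a(β) → 0`;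
cells of side `⌈K/a(β)⌉`) and `K, γ > 0` such that for every patch size `n₀ ≥ 1` there is `β₂(n₀)` beyond which, on
every torus `(ℤ/N)⁴` with `N ≥ (4n₀+8)⌈K/a(β)⌉`, `LocalPoincare r.ρ β N ⌈K/a(β)⌉ n₀ γ` holds.  The landed pipeline `reduction_concl_of_localPoincare` (Knabe amplification of the local inequality to the global
Poincaré inequality of the sampler on the torus, then gap ⇒ clustering through the finite speed of propagation of the
block semigroup) gives, for every pair of gauge-invariant local observables, `|corr_{β,2S+1}(A,B,n)| ≤ C(A,B)
e^{−c₁ a(β) n}` for `β ≥ β₂`, `S ≥ S₁(β)`, `n ≤ S`, with `C(A,B)` uniform in `β`; this is the crux with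
`m(β) := c₁ a(β) > 0`. [folklore] -/
theorem latticeGapLargeBeta_of_blockSamplerLocalPoincare :
    (∀ (G : Type) [Group G] [TopologicalSpace G] [IsTopologicalGroup G] [CompactSpace G] [MeasurableSpace G]
      [BorelSpace G], Literature.MathematicalPhysics.QuantumFieldTheory.IsCompactSimpleLieGroup G →
      ∀ r : Literature.MathematicalPhysics.QuantumFieldTheory.LatticeRep G, ∃ (a : ℝ → ℝ) (K γ : ℝ),
      (∀ β, 0 < a β) ∧ Filter.Tendsto a Filter.atTop (nhds 0) ∧ 0 < K ∧ 0 < γ ∧ ∀ n₀ : ℕ, 1 ≤ n₀ →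
      ∃ β₂ : ℝ, ∀ β : ℝ, β₂ ≤ β → ∀ (N : ℕ) [NeZero N], (4 * n₀ + 8) * ⌈K / a β⌉₊ ≤ N →
      Literature.MathematicalPhysics.QuantumLattice.WilsonBlockHeatBath.LocalPoincare r.ρ β N ⌈K / a β⌉₊ n₀ γ) →
    Summit.QuantumFields.YangMills.Theses.EquipartitionCriticality.LatticeGapLargeBeta := by
  intro h G _ _ _ _ hG
  letI : MeasurableSpace G := borel G
  haveI : BorelSpace G := ⟨rfl⟩
  intro r
  obtain ⟨a, K, γ, hpos, hlim, hK, hγ, hloc⟩ := h G hG r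
  obtain ⟨c₁, β₂, S₁, hc₁, hAB⟩ :=
    LatticeGapInUVUnits.KnabeBlockSampler.reduction_concl_of_localPoincare r hpos hlim hK hγ hloc
  refine ⟨β₂, fun β => c₁ * a β, S₁, fun β _ => mul_pos hc₁ (hpos β), fun A B => ?_⟩
  obtain ⟨C, hC⟩ := hAB A B
  exact ⟨C, fun β hβ S n hS hn => hC β hβ S n hS hn⟩

end Summit.QuantumFields.YangMills.Theorems.LatticeGapLargeBeta

end
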